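import Summits.CriticalPhenomena.PercolationContinuityZ3.Theorems.PercNearOneGluingNoHeavyLowerTailCILSubStarReference
import Summits.CriticalPhenomena.PercolationContinuityZ3.Theorems.PercNearOneGluingNoHeavyLowerTailCILStarTransfer
import HarnessLib

/-!
# `NoHeavyLowerTail` (stmt-CriticalPhenomena-4575) — the first open CIL class (an observer with TWO light Steiner neighbours,
# each a pendant relay-star) reduces to ONE inequality: the TWO-PENDANT-STARS inequality (TPS)

Support file (prover `prim-hp-2`, hull-port / deletion–contraction line; `--supports stmt-CriticalPhenomena-4575`).
No definitions, no named facts, no sorries.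

`μ_w = prodBernoulli w` on `Fin n`, relays `A`, level `j`, `π(v) = {a ∈ A : v ↔ a}`, `N = |π(o)|`.  CIL at `o` (`stub_cumulativeIsolation`)
is a tree theorem when the hull of `o` (its component in the non-relay graph) is `{o}` (`cil_relayNeighbours`) or a Steiner path ending at `o`
(`cil_steinerPath`, `cil_of_oneLightSteinerNeighbour`), and when at most two relays ("gates") touch the hull (`TwoGate.step_of_twoGate`).  The
smallest configuration covered by none of these is the TWO-PENDANT-STARS observer: `o ∉ A` adjacent to relays and to two non-relays `s₁ ≠ s₂`,
`s₁ ≁ s₂`, each `s_k` adjacent (apart from `o`) only to relays `P_k ⊆ A`, `|P₁ ∪ P₂| ≥ 3`.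

`cil_twoPendantStars_of_TPS`: for such an observer, CIL at `o` with the `H`-champion `q` as witness (`H = G − o`, `q` maximises
`μ{|π_H(·)| ≤ j}` over `A`) follows from the single set-champion-stability inequality for the pair `{s₁, s₂}` in `H`:

  TPS(H, s₁, s₂, q):  `μ_H(q ↮ s₁, q ↮ s₂, 1 ≤ |π_H(s₁) ∪ π_H(s₂)| ≤ j) ≤ μ_H(q ↮ s₁, q ↮ s₂, |π_H(q)| ≤ j)`,

stated for the weight function `w_o` (edges at `o` switched off), in which `s₁, s₂` are two non-adjacent pendant relay-stars and `q` dominates every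
relay.  Proof: `cil_of_starStability` (star transfer); the light stars of `o` are subsets of `{s₁, s₂}` (relays are no `H`-lighter than the champion);
the singletons `{s_k}` are discharged by `cil_of_portDomination` in `w_o` (reference `w_o` itself) + `SubStar.setCS_singleton_of_cil`, transferred by
`CutObserver.measureReal_preimage_avoid`; the pair is TPS.  (Equivalently TPS says: `q` is a valid CIL witness for the glued observer `s₁ = s₂` in
`w_o/(s₁~s₂)`, i.e. domination of the gates in the SPLIT reference `w_o` suffices — the `|S| = 2` case of the relay-neighboured observer SET problem;
numerically 0 violations, crux notes of prim-hp-2.)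
-/

noncomputable section

namespace Summit.CriticalPhenomena.PercolationContinuityZ3.Theorems

open MeasureTheory Set Literature.Probability.LatticeModels Literature.Probability.Percolation
open scoped Classical BigOperators

variable {n : ℕ}

namespace TwoPendantStars

open CutObserver SubStar

/-- `H`-lightness events are preimages under `ω ↦ ω ∩ {e | o ∉ e}`: transfer of a one-vertex lightness probability to the weight
function with the edges at `o` switched off. -/
theorem real_lightness_avoid (w : Sym2 (Fin n) → unitInterval) (A : Finset (Fin n)) (o x : Fin n) (j : ℕ) :
    (prodBernoulli w).real {ω : BondConfig (Fin n) |
        (A.filter fun z => (openGraph (ω ∩ {e | o ∉ e})).Reachable x z).card ≤ j} =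
      (prodBernoulli fun e => if e ∈ {e : Sym2 (Fin n) | o ∉ e} then w e else 0).real
        {ω : BondConfig (Fin n) | (A.filter fun z => ω ∈ openConn x z).card ≤ j} := by
  rw [← measureReal_preimage_avoid w o]
  congr 1; ext ω; simp only [mem_setOf_eq, filter_avoid_eq]

/-- Transfer of the set-champion-stability pair of events for a finite set `B` and witness `q`. -/
theorem real_setL_avoid (w : Sym2 (Fin n) → unitInterval) (A B : Finset (Fin n)) (o q : Fin n) (j : ℕ) :
    (prodBernoulli w).real {ω : BondConfig (Fin n) |
        (∀ y ∈ B, ¬ (openGraph (ω ∩ {e | o ∉ e})).Reachable q y) ∧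
          1 ≤ (A.filter fun z => ∃ y ∈ B, (openGraph (ω ∩ {e | o ∉ e})).Reachable y z).card ∧
          (A.filter fun z => ∃ y ∈ B, (openGraph (ω ∩ {e | o ∉ e})).Reachable y z).card ≤ j} =
      (prodBernoulli fun e => if e ∈ {e : Sym2 (Fin n) | o ∉ e} then w e else 0).real
        {ω : BondConfig (Fin n) | (∀ y ∈ B, ω ∉ openConn q y) ∧
          1 ≤ (A.filter fun z => ∃ y ∈ B, ω ∈ openConn y z).card ∧
          (A.filter fun z => ∃ y ∈ B, ω ∈ openConn y z).card ≤ j} := by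
  rw [← measureReal_preimage_avoid w o]
  congr 1; ext ω; simp only [mem_setOf_eq, filter_avoid_exists_eq]; exact Iff.rfl

/-- Transfer of the right-hand (witness) event of set-champion stability for a finite set `B` and witness `q`. -/
theorem real_setR_avoid (w : Sym2 (Fin n) → unitInterval) (A B : Finset (Fin n)) (o q : Fin n) (j : ℕ) :
    (prodBernoulli w).real {ω : BondConfig (Fin n) |
        (∀ y ∈ B, ¬ (openGraph (ω ∩ {e | o ∉ e})).Reachable q y) ∧
          (A.filter fun z => (openGraph (ω ∩ {e | o ∉ e})).Reachable q z).card ≤ j} =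
      (prodBernoulli fun e => if e ∈ {e : Sym2 (Fin n) | o ∉ e} then w e else 0).real
        {ω : BondConfig (Fin n) | (∀ y ∈ B, ω ∉ openConn q y) ∧
          (A.filter fun z => ω ∈ openConn q z).card ≤ j} := by
  rw [← measureReal_preimage_avoid w o]
  congr 1; ext ω; simp only [mem_setOf_eq, filter_avoid_eq]; exact Iff.rfl

end TwoPendantStars

open CutObserver SubStar TwoPendantStars in
/-- **CIL for the two-pendant-stars observer, from TPS.**  Let `o ∉ A` have positive-weight neighbours only among the relays and two
non-relays `s₁, s₂`, each `s_k` having, apart from `o`, only relay neighbours (so `w s(s₁,s₂) = 0`) and at least one of them.  Let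
`q ∈ A` be an `H`-champion (`H` = no edge at `o`: `μ{|π_H(a)| ≤ j} ≤ μ{|π_H(q)| ≤ j}` for all `a ∈ A`).  Write `w_o` for `w` with the edges
at `o` switched off.  IF the two-pendant-stars inequality TPS holds for `(w_o, s₁, s₂, q)` —
`μ_{w_o}(q ↮ s₁, q ↮ s₂, 1 ≤ |π(s₁) ∪ π(s₂)| ≤ j) ≤ μ_{w_o}(q ↮ s₁, q ↮ s₂, |π(q)| ≤ j)` (hypothesis `hTPS`) — THEN
`μ_w{1 ≤ N ≤ j} ≤ μ_w{|π(q)| ≤ j}`, the conclusion of `stub_cumulativeIsolation` (crux `NoHeavyLowerTail`, stmt-CriticalPhenomena-4575)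
with the witness `q`.  Mechanism: star transfer `cil_of_starStability`; light stars are subsets of `{s₁, s₂}`; singletons by
`cil_of_portDomination` in `w_o` + `setCS_singleton_of_cil` + `measureReal_preimage_avoid`; the pair is `hTPS`.
[cite: VandenbergHaggstromKahn2005, Thm. 1.5 (p. 7); KozmaNitzan2024, Lemma 5 (p. 13) — star decomposition] -/
theorem cil_twoPendantStars_of_TPS (w : Sym2 (Fin n) → unitInterval) (A : Finset (Fin n)) (o s₁ s₂ q : Fin n) (j : ℕ)
    (hoA : o ∉ A) (hs₁A : s₁ ∉ A) (hs₂A : s₂ ∉ A) (hs₁o : s₁ ≠ o) (hs₂o : s₂ ≠ o)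
    (hobs : ∀ v, w s(o, v) ≠ 0 → v ∈ A ∨ v = s₁ ∨ v = s₂)
    (hobs₁ : ∀ v, v ≠ o → w s(s₁, v) ≠ 0 → v ∈ A) (hobs₂ : ∀ v, v ≠ o → w s(s₂, v) ≠ 0 → v ∈ A)
    (hne₁ : ∃ v ∈ A, w s(s₁, v) ≠ 0) (hne₂ : ∃ v ∈ A, w s(s₂, v) ≠ 0)
    (hqA : q ∈ A)
    (hchamp : ∀ a ∈ A,
      (prodBernoulli w).real {ω : BondConfig (Fin n) |
          (A.filter fun z => (openGraph (ω ∩ {e | o ∉ e})).Reachable a z).card ≤ j} ≤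
        (prodBernoulli w).real {ω : BondConfig (Fin n) |
          (A.filter fun z => (openGraph (ω ∩ {e | o ∉ e})).Reachable q z).card ≤ j})
    (hTPS : (prodBernoulli fun e => if e ∈ {e : Sym2 (Fin n) | o ∉ e} then w e else 0).real
        {ω : BondConfig (Fin n) | (∀ y ∈ ({s₁, s₂} : Finset (Fin n)), ω ∉ openConn q y) ∧
          1 ≤ (A.filter fun z => ∃ y ∈ ({s₁, s₂} : Finset (Fin n)), ω ∈ openConn y z).card ∧
          (A.filter fun z => ∃ y ∈ ({s₁, s₂} : Finset (Fin n)), ω ∈ openConn y z).card ≤ j} ≤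
      (prodBernoulli fun e => if e ∈ {e : Sym2 (Fin n) | o ∉ e} then w e else 0).real
        {ω : BondConfig (Fin n) | (∀ y ∈ ({s₁, s₂} : Finset (Fin n)), ω ∉ openConn q y) ∧
          (A.filter fun z => ω ∈ openConn q z).card ≤ j}) :
    (prodBernoulli w).real {ω : BondConfig (Fin n) |
        1 ≤ (A.filter fun x => ω ∈ openConn o x).card ∧ (A.filter fun x => ω ∈ openConn o x).card ≤ j} ≤
      (prodBernoulli w).real {ω : BondConfig (Fin n) | (A.filter fun x => ω ∈ openConn q x).card ≤ j} := by
  -- the reference weight function `w_o`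
  set wo : Sym2 (Fin n) → unitInterval := fun e => if e ∈ {e : Sym2 (Fin n) | o ∉ e} then w e else 0 with hwo
  have hqo : q ≠ o := fun h => hoA (h ▸ hqA)
  have hwo_of : ∀ u v : Fin n, o ∉ s(u, v) → wo s(u, v) = w s(u, v) := by
    intro u v h
    simp only [hwo, Set.mem_setOf_eq, h, not_false_eq_true, if_true]
  have hwo_o : ∀ v : Fin n, wo s(o, v) = 0 := by
    intro v
    have : ¬ (o ∉ s(o, v)) := fun h => h (Sym2.mem_mk_left o v)
    simp only [hwo, Set.mem_setOf_eq, this, if_false]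
  -- singleton stars: CS({s_k}, q) in `w_o` from port domination in `w_o`
  have hsingle : ∀ s : Fin n, s ∉ A → s ≠ o → (∀ v, v ≠ o → w s(s, v) ≠ 0 → v ∈ A) → (∃ v ∈ A, w s(s, v) ≠ 0) →
      (prodBernoulli wo).real {ω : BondConfig (Fin n) | (∀ x ∈ ({s} : Finset (Fin n)), ω ∉ openConn q x) ∧
          1 ≤ (A.filter fun z => ∃ x ∈ ({s} : Finset (Fin n)), ω ∈ openConn x z).card ∧
          (A.filter fun z => ∃ x ∈ ({s} : Finset (Fin n)), ω ∈ openConn x z).card ≤ j} ≤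
        (prodBernoulli wo).real {ω : BondConfig (Fin n) | (∀ x ∈ ({s} : Finset (Fin n)), ω ∉ openConn q x) ∧
          (A.filter fun z => ω ∈ openConn q z).card ≤ j} := by
    intro s hsA hso hnbr hne
    -- ports of `s` in `w_o`
    set P : Finset (Fin n) := A.filter fun v => wo s(s, v) ≠ 0 with hP
    have hPne : P.Nonempty := by
      obtain ⟨v, hvA, hv⟩ := hne
      refine ⟨v, Finset.mem_filter.2 ⟨hvA, ?_⟩⟩
      have hov : o ∉ s(s, v) := by
        rw [Sym2.mem_iff, not_or]
        exact ⟨fun h => hso h.symm, fun h => hoA (h ▸ hvA)⟩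
      rw [hwo_of s v hov]; exact hv
    set d : ℕ := P.card with hd
    have hdpos : 0 < d := Finset.card_pos.2 hPne
    let p : Fin d → Fin n := fun l => ((P.equivFin.symm l) : Fin n)
    have hp : Function.Injective p := by
      intro l m hlm
      have : P.equivFin.symm l = P.equivFin.symm m := Subtype.ext hlm
      exact P.equivFin.symm.injective this
    have hpP : ∀ l, p l ∈ P := fun l => (P.equivFin.symm l).2
    have hpA : ∀ l, p l ∈ A := fun l => (Finset.mem_filter.1 (hpP l)).1
    have hobs' : ∀ v, wo s(s, v) ≠ 0 → ∃ l, v = p l := by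
      intro v hv
      have hov : o ∉ s(s, v) := by
        intro h
        apply hv
        have : ¬ (o ∉ s(s, v)) := fun h' => h' h
        simp only [hwo, Set.mem_setOf_eq, this, if_false]
      have hvo : v ≠ o := fun h => hov (h ▸ Sym2.mem_mk_right s v)
      have hvw : w s(s, v) ≠ 0 := by rw [← hwo_of s v hov]; exact hv
      have hvA : v ∈ A := hnbr v hvo hvw
      have hvP : v ∈ P := Finset.mem_filter.2 ⟨hvA, hv⟩
      refine ⟨P.equivFin ⟨v, hvP⟩, ?_⟩
      show v = ((P.equivFin.symm (P.equivFin ⟨v, hvP⟩)) : Fin n)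
      rw [Equiv.symm_apply_apply]
    have hdom : ∀ l : Fin d,
        (prodBernoulli wo).real {ω : BondConfig (Fin n) | (A.filter fun x => ω ∈ openConn (p l) x).card ≤ j} ≤
          (prodBernoulli wo).real {ω : BondConfig (Fin n) | (A.filter fun x => ω ∈ openConn q x).card ≤ j} := by
      intro l
      have h := hchamp (p l) (hpA l)
      rw [real_lightness_avoid w A o (p l) j, real_lightness_avoid w A o q j] at h
      exact h
    have hcil := cil_of_portDomination wo A s j p hp hpA hsA hdpos hobs' q hdom
    exact setCS_singleton_of_cil wo A s q j hqA hcil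
  -- star transfer
  refine cil_of_starStability w A o q j hoA hqo ?_
  intro B hBne hB
  -- every member of `B` is `s₁` or `s₂`
  have hBsub : ∀ y ∈ B, y = s₁ ∨ y = s₂ := by
    intro y hy
    obtain ⟨hyo, hwy, hlt⟩ := hB y hy
    rcases hobs y hwy with hyA | h | h
    · exact absurd (hchamp y hyA) (not_le.2 hlt)
    · exact Or.inl h
    · exact Or.inr h
  -- case analysis on `B ⊆ {s₁, s₂}`
  by_cases h1 : s₁ ∈ B
  · by_cases h2 : s₂ ∈ B
    · -- `B = {s₁, s₂}`: TPS
      have hBeq : B = ({s₁, s₂} : Finset (Fin n)) := by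
        ext y
        constructor
        · intro hy
          rcases hBsub y hy with h | h <;> simp [h]
        · intro hy
          rcases Finset.mem_insert.1 hy with h | h
          · exact h ▸ h1
          · rw [Finset.mem_singleton] at h; exact h ▸ h2
      rw [hBeq, real_setL_avoid w A {s₁, s₂} o q j, real_setR_avoid w A {s₁, s₂} o q j]
      exact hTPS
    · -- `B = {s₁}`
      have hBeq : B = ({s₁} : Finset (Fin n)) := by
        ext y
        constructor
        · intro hy
          rcases hBsub y hy with h | h
          · simp [h]
          · exact absurd (h ▸ hy) h2
        · intro hy; rw [Finset.mem_singleton] at hy; exact hy ▸ h1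
      rw [hBeq, real_setL_avoid w A {s₁} o q j, real_setR_avoid w A {s₁} o q j]
      exact hsingle s₁ hs₁A hs₁o hobs₁ hne₁
  · -- `s₁ ∉ B`, so `B = {s₂}`
    have h2 : s₂ ∈ B := by
      obtain ⟨y, hy⟩ := hBne
      rcases hBsub y hy with h | h
      · exact absurd (h ▸ hy) h1
      · exact h ▸ hy
    have hBeq : B = ({s₂} : Finset (Fin n)) := by
      ext y
      constructor
      · intro hy
        rcases hBsub y hy with h | h
        · exact absurd (h ▸ hy) h1
        · simp [h]
      · intro hy; rw [Finset.mem_singleton] at hy; exact hy ▸ h2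
    rw [hBeq, real_setL_avoid w A {s₂} o q j, real_setR_avoid w A {s₂} o q j]
    exact hsingle s₂ hs₂A hs₂o hobs₂ hne₂

end Summit.CriticalPhenomena.PercolationContinuityZ3.Theorems

end
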